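import Summits.ResolutionOfSingularities.ResolutionOfSingularities.Theorems.FrobeniusLadderFInjectiveMacaulayficationTauFloorP2d5CYChartIdent
import Summits.ResolutionOfSingularities.ResolutionOfSingularities.Theorems.FrobeniusLadderFInjectiveMacaulayficationTauFloorBXChartNotFull
import HarnessLib

/-!
# (O-1′-Y″) The prime `𝔮 = (x̄, ȳ, z̄′)` of the `D(ȳ)` chart `T₂` of `Bl_τ(P2d5C)` — the generic point of the exceptional divisor on that chart: `𝔮 = ker κ`,
# `height 𝔮 = 1`, `dim (T₂)_𝔮 = 1`, and ★★ `¬ FullCl 2 ((T₂)_𝔮)` — the F-clause FAILS for the parameter `x̄`; hence every point of `V(𝔮)` is a NON-FULL point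
# (a 4-dimensional non-FULL locus on floor 1 of the first d = 5 row), and the chart `A₀[τ/ȳ]` has a NON-FULL prime containing `ȳ/1`
# (crux `FInjectiveMacaulayfication` stmt-ResolutionOfSingularities-15315, chain w45a; res-L1-w45a-plan-1 g19 RULING R19.15 «(O-1′) → stub-1», the `not_full` half, as
# specified by res-L1-w45a-stub-3 g10 («non-FULL prime (x̄, ȳ, z̄′)»); pattern = res-L1-w45a-stub-2's p634876 `…TauFloorBXChartNotFull` with a ONE-ε target one
# dimension down; seat res-L1-w45a-stub-1 g11)

[OURS · L1 W4.5a] Support file (`--supports stmt-ResolutionOfSingularities-15315 --as helper`); replaces the role of NO printed item; NOT a statement of any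
manuscript; def-free; UNCONDITIONAL. §1–§2 and §4 hold over ANY field `k`; the point-wise form §3 assumes `CharP k 2` (the clause transport
`ClauseLocalizes.fiClause_of_specializes` is stated for stalks of characteristic `p`). AI-written (AI review is weaker than expert review).

SETTING (from `…TauFloorP2d5CYChartAlgebra`): `B₀ = k[y, w, u′, t′, s′] = MvPolynomial (Fin 5) k`, `T₂ = B₀[x][z′] = AdjoinRoot h₂` over `AdjoinRoot h₁`,
`h₁ = X² − yw`, `h₂ = Z² + (yw²Z + y(1 + u′³ + t′³ + s′³))` (= the `D(ȳ)` chart of `Bl_τ X`, `X = P2d5C = V(z² + x⁴z + y³ + u³ + t³ + s³)`, `τ = (x̄², ȳ, ū, t̄, s̄, z̄)`);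
`κ : T₂ → B₀` the kill map (`y ↦ 0` on `B₀`, `x̄, z̄′ ↦ 0`), a hypothesis with its three defining values (it exists: `TauFloorP2d5CYChartAlgebra.exists_killMap`).
* §1 ★ `ker_killMap_eq : ker κ = (ȳ, x̄, z̄′)` (normal forms `a₀ + a₁x̄ + (b₀ + b₁x̄)z̄′`), `under_kerKillMap : ker κ ∩ B₀ = (y)`, ★ `height_kerKillMap : height (ker κ) = 1`
  (INCOMPARABILITY + GOING-DOWN over `height (y) = 1`), `ringKrullDim_localization_kerKillMap : dim (T₂)_𝔮 = 1`, `algebraMap_X1_not_mem` (`w̄ ∉ 𝔮`).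
* §2 ★★ `not_fullCl_localization_kerKillMap : ¬ FullCl 2 ((T₂)_𝔮)`: `s = (x̄)` is a system of parameters of the 1-dimensional local ring `(T₂)_𝔮` (`w̄` is a unit
  there, so `ȳ = x̄²·w̄⁻¹ ∈ (x̄)` and `z̄′² = −ȳ(w̄²z̄′ + 1 + Σ′) ∈ (x̄)`, i.e. `√(x̄) = 𝔮(T₂)_𝔮`); the element `z̄′` has `z̄′² = x̄²·(−w̄⁻¹(w̄²z̄′ + 1 + Σ′)) ∈ (x̄²) = (s)^{[2]}`,
  but `z̄′ ∉ (x̄)(T₂)_𝔮`: the map `T₂ → F[ε]` (`F ⊇ B₀/(y)` a field; `y ↦ 0`, `x̄ ↦ 0`, `z̄′ ↦ ε` — legitimate by the UNIVERSAL PROPERTY: `0² = 0·w`, `ε² + 0 + 0 = 0`)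
  sends `T₂ ∖ 𝔮` to units (its `fst` is `Frac ∘ κ`), hence extends to `(T₂)_𝔮`, kills `(s)`, and maps `z̄′ ↦ ε ≠ 0`. So clause 3 of `FullCl 2` fails at `e = 1`.
* §3 ★★ `not_fullCl_stalk_of_mem` [`CharP k 2`]: `¬ FullCl 2 (𝒪_{Spec T₂, w})` at EVERY point `w ∈ V(ȳ, x̄, z̄′)` (FULL generizes; the generic point is not FULL).
* §4 ★★ `exists_prime_not_fullCl_blowupAlgebra` (any field): a prime `Q ∋ ȳ/1` of `A₀[τ/ȳ] = blowupAlgebra τ ȳ` with `¬ FullCl 2` (transport along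
  `TauFloorP2d5CYChartIdent.exists_chartEquiv`) — the input of `TauFloorInputNotFull.exists_point_over_centre_not_fullCl` for the row's «NOT F(5)-iso».
[cite: Matsumura1987, Thm. 9.3, Thm. 9.5, Thm. 13.5] [cite: Fedder1983, Prop. 1.7 (context)]
-/

-- single-problem summit: the doubled namespace component is forced
set_option linter.dupNamespace false

noncomputable section

namespace Summit.ResolutionOfSingularities.ResolutionOfSingularities.Theorems.FInjectiveMacaulayfication.TauFloorP2d5CYChartNotFull

open MvPolynomial IsLocalization AlgebraicGeometry CategoryTheory Literature.AlgebraicGeometry.Resolution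
open Summit.ResolutionOfSingularities.ResolutionOfSingularities.Theorems.FInjectiveMacaulayfication
open SliceableCentre TauFloorP2d5CYChartAlgebra

variable (k : Type) [Field k]

/-! ## §1 The prime `𝔮 = ker κ = (ȳ, x̄, z̄′)`, its height, the local dimension -/

/-- `κ` restricted to `B₀` is `y ↦ 0`. [plumbing] -/
theorem killMap_algebraMap (h₁ : Polynomial (MvPolynomial (Fin 5) k)) (h₂ : Polynomial (AdjoinRoot h₁))
    (κ : AdjoinRoot h₂ →+* MvPolynomial (Fin 5) k)
    (hκ : κ.comp (algebraMap (MvPolynomial (Fin 5) k) (AdjoinRoot h₂)) = (aeval (fun i : Fin 5 => if i = 0 then (0 : MvPolynomial (Fin 5) k) else X i)).toRingHom ∧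
      κ (AdjoinRoot.of h₂ (AdjoinRoot.root h₁)) = 0 ∧ κ (AdjoinRoot.root h₂) = 0)
    (b : MvPolynomial (Fin 5) k) : κ (algebraMap (MvPolynomial (Fin 5) k) (AdjoinRoot h₂) b) = aeval (fun i : Fin 5 => if i = 0 then (0 : MvPolynomial (Fin 5) k) else X i) b := by
  have h := RingHom.congr_fun hκ.1 b
  simpa using h

/-- ★ **`ker κ = (ȳ, x̄, z̄′)`** — by the normal form `e = a₀ + a₁x̄ + (b₀ + b₁x̄)z̄′` (`aᵢ, bᵢ ∈ B₀`): `κ(e) = a₀(y ↦ 0)`. [folklore] -/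
theorem ker_killMap_eq (h₁ : Polynomial (MvPolynomial (Fin 5) k)) (hh₁ : h₁ = Polynomial.X ^ 2 - Polynomial.C (X 0 * X 1))
    (h₂ : Polynomial (AdjoinRoot h₁))
    (hh₂ : h₂ = Polynomial.X ^ 2 + (Polynomial.C (algebraMap (MvPolynomial (Fin 5) k) (AdjoinRoot h₁) (X 0 * X 1 ^ 2)) * Polynomial.X +
      Polynomial.C (algebraMap (MvPolynomial (Fin 5) k) (AdjoinRoot h₁) (X 0 * (1 + X 2 ^ 3 + X 3 ^ 3 + X 4 ^ 3)))))
    (κ : AdjoinRoot h₂ →+* MvPolynomial (Fin 5) k)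
    (hκ : κ.comp (algebraMap (MvPolynomial (Fin 5) k) (AdjoinRoot h₂)) = (aeval (fun i : Fin 5 => if i = 0 then (0 : MvPolynomial (Fin 5) k) else X i)).toRingHom ∧
      κ (AdjoinRoot.of h₂ (AdjoinRoot.root h₁)) = 0 ∧ κ (AdjoinRoot.root h₂) = 0) :
    RingHom.ker κ = Ideal.span {algebraMap (MvPolynomial (Fin 5) k) (AdjoinRoot h₂) (X 0), AdjoinRoot.of h₂ (AdjoinRoot.root h₁), AdjoinRoot.root h₂} := by
  have hyI : algebraMap (MvPolynomial (Fin 5) k) (AdjoinRoot h₂) (X 0) ∈ Ideal.span {algebraMap (MvPolynomial (Fin 5) k) (AdjoinRoot h₂) (X 0), AdjoinRoot.of h₂ (AdjoinRoot.root h₁), AdjoinRoot.root h₂} := Ideal.subset_span (Set.mem_insert _ _)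
  have hxI : AdjoinRoot.of h₂ (AdjoinRoot.root h₁) ∈ Ideal.span {algebraMap (MvPolynomial (Fin 5) k) (AdjoinRoot h₂) (X 0), AdjoinRoot.of h₂ (AdjoinRoot.root h₁), AdjoinRoot.root h₂} := Ideal.subset_span (Set.mem_insert_of_mem _ (Set.mem_insert _ _))
  have hzI : AdjoinRoot.root h₂ ∈ Ideal.span {algebraMap (MvPolynomial (Fin 5) k) (AdjoinRoot h₂) (X 0), AdjoinRoot.of h₂ (AdjoinRoot.root h₁), AdjoinRoot.root h₂} := Ideal.subset_span (Set.mem_insert_of_mem _ (Set.mem_insert_of_mem _ rfl))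
  apply le_antisymm
  · intro e he
    rw [RingHom.mem_ker] at he
    obtain ⟨a, b, rfl⟩ := TauFloorBXChartAlgebra.exists_nf_of_monic_two (monic_h₂ k h₁ h₂ hh₂) (natDegree_h₂_le k h₁ h₂ hh₂) e
    obtain ⟨a₀, a₁, rfl⟩ := TauFloorBXChartAlgebra.exists_nf_of_monic_two (monic_h₁ k h₁ hh₁) (natDegree_h₁_le k h₁ hh₁) a
    have hκa₀ : aeval (fun i : Fin 5 => if i = 0 then (0 : MvPolynomial (Fin 5) k) else X i) a₀ = 0 := by
      simp only [map_add, map_mul, hκ.2.2, mul_zero, add_zero, hκ.2.1, ← algebraMap_tower_apply, killMap_algebraMap k h₁ h₂ κ hκ] at he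
      exact he
    have ha₀ : a₀ ∈ Ideal.span ({X 0} : Set (MvPolynomial (Fin 5) k)) := by
      rw [← ker_killY_eq]; exact hκa₀
    have ha₀' : AdjoinRoot.of h₂ (AdjoinRoot.of h₁ a₀) ∈ Ideal.span {algebraMap (MvPolynomial (Fin 5) k) (AdjoinRoot h₂) (X 0), AdjoinRoot.of h₂ (AdjoinRoot.root h₁), AdjoinRoot.root h₂} := by
      have h := Ideal.mem_map_of_mem (algebraMap (MvPolynomial (Fin 5) k) (AdjoinRoot h₂)) ha₀
      rw [Ideal.map_span, Set.image_singleton, algebraMap_tower_apply] at h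
      exact (Ideal.span_le.mpr (Set.singleton_subset_iff.mpr hyI)) h
    rw [map_add, map_mul]
    exact Ideal.add_mem _ (Ideal.add_mem _ ha₀' (Ideal.mul_mem_left _ _ hxI)) (Ideal.mul_mem_left _ _ hzI)
  · rw [Ideal.span_le]
    rintro r hr
    rw [SetLike.mem_coe, RingHom.mem_ker]
    rcases hr with rfl | rfl | rfl
    · rw [killMap_algebraMap k h₁ h₂ κ hκ, killY_X]; simp
    · exact hκ.2.1
    · exact hκ.2.2

/-- `ker κ ∩ B₀ = (y)`. [plumbing] -/
theorem under_kerKillMap (h₁ : Polynomial (MvPolynomial (Fin 5) k)) (h₂ : Polynomial (AdjoinRoot h₁))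
    (κ : AdjoinRoot h₂ →+* MvPolynomial (Fin 5) k)
    (hκ : κ.comp (algebraMap (MvPolynomial (Fin 5) k) (AdjoinRoot h₂)) = (aeval (fun i : Fin 5 => if i = 0 then (0 : MvPolynomial (Fin 5) k) else X i)).toRingHom ∧
      κ (AdjoinRoot.of h₂ (AdjoinRoot.root h₁)) = 0 ∧ κ (AdjoinRoot.root h₂) = 0) :
    (RingHom.ker κ).under (MvPolynomial (Fin 5) k) = Ideal.span {X 0} := by
  rw [Ideal.under_def, RingHom.comap_ker, hκ.1]
  exact ker_killY_eq k

/-- ★ **`height (ker κ) = 1`**: `T₂ ⊇ B₀` is finite (INCOMPARABILITY `ht 𝔮 ≤ ht (𝔮 ∩ B₀)`, `FlatIntegralCM.height_le_height_under_of_isIntegral`) and free, hence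
flat (GOING-DOWN `ht 𝔮 ≥ ht (𝔮 ∩ B₀)`, Mathlib `Ideal.height_eq_height_add_of_liesOver_of_hasGoingDown`), and `𝔮 ∩ B₀ = (y)` has height `1`.
[cite: Matsumura1987, Thm. 9.3 (ii), Thm. 9.5, Thm. 13.5] -/
theorem height_kerKillMap (h₁ : Polynomial (MvPolynomial (Fin 5) k)) (hh₁ : h₁ = Polynomial.X ^ 2 - Polynomial.C (X 0 * X 1))
    (h₂ : Polynomial (AdjoinRoot h₁))
    (hh₂ : h₂ = Polynomial.X ^ 2 + (Polynomial.C (algebraMap (MvPolynomial (Fin 5) k) (AdjoinRoot h₁) (X 0 * X 1 ^ 2)) * Polynomial.X +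
      Polynomial.C (algebraMap (MvPolynomial (Fin 5) k) (AdjoinRoot h₁) (X 0 * (1 + X 2 ^ 3 + X 3 ^ 3 + X 4 ^ 3)))))
    (κ : AdjoinRoot h₂ →+* MvPolynomial (Fin 5) k)
    (hκ : κ.comp (algebraMap (MvPolynomial (Fin 5) k) (AdjoinRoot h₂)) = (aeval (fun i : Fin 5 => if i = 0 then (0 : MvPolynomial (Fin 5) k) else X i)).toRingHom ∧
      κ (AdjoinRoot.of h₂ (AdjoinRoot.root h₁)) = 0 ∧ κ (AdjoinRoot.root h₂) = 0) :
    (RingHom.ker κ).height = 1 := by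
  haveI : (RingHom.ker κ).IsPrime := RingHom.ker_isPrime κ
  obtain ⟨hfree, hfin⟩ := free_finite_tower k h₁ hh₁ h₂ hh₂
  haveI : Algebra.IsIntegral (MvPolynomial (Fin 5) k) (AdjoinRoot h₂) := Algebra.IsIntegral.of_finite _ _
  have hu := under_kerKillMap k h₁ h₂ κ hκ
  apply le_antisymm
  · have h := FlatIntegralCM.height_le_height_under_of_isIntegral (A := MvPolynomial (Fin 5) k) (RingHom.ker κ)
    rwa [hu, height_span_X0] at h
  · haveI : (Ideal.span ({X 0} : Set (MvPolynomial (Fin 5) k))).IsPrime := isPrime_span_X0 k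
    haveI : (RingHom.ker κ).LiesOver (Ideal.span ({X 0} : Set (MvPolynomial (Fin 5) k))) := ⟨hu.symm⟩
    have h := Ideal.height_eq_height_add_of_liesOver_of_hasGoingDown (Ideal.span ({X 0} : Set (MvPolynomial (Fin 5) k))) (RingHom.ker κ)
    rw [height_span_X0] at h
    rw [h]
    exact le_self_add

/-- ★ **`dim (T₂)_𝔮 = 1`** at `𝔮 = ker κ = (ȳ, x̄, z̄′)` — the generic point of the exceptional divisor of the chart. [folklore] -/
theorem ringKrullDim_localization_kerKillMap (h₁ : Polynomial (MvPolynomial (Fin 5) k)) (hh₁ : h₁ = Polynomial.X ^ 2 - Polynomial.C (X 0 * X 1))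
    (h₂ : Polynomial (AdjoinRoot h₁))
    (hh₂ : h₂ = Polynomial.X ^ 2 + (Polynomial.C (algebraMap (MvPolynomial (Fin 5) k) (AdjoinRoot h₁) (X 0 * X 1 ^ 2)) * Polynomial.X +
      Polynomial.C (algebraMap (MvPolynomial (Fin 5) k) (AdjoinRoot h₁) (X 0 * (1 + X 2 ^ 3 + X 3 ^ 3 + X 4 ^ 3)))))
    (κ : AdjoinRoot h₂ →+* MvPolynomial (Fin 5) k)
    (hκ : κ.comp (algebraMap (MvPolynomial (Fin 5) k) (AdjoinRoot h₂)) = (aeval (fun i : Fin 5 => if i = 0 then (0 : MvPolynomial (Fin 5) k) else X i)).toRingHom ∧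
      κ (AdjoinRoot.of h₂ (AdjoinRoot.root h₁)) = 0 ∧ κ (AdjoinRoot.root h₂) = 0)
    (Q : Ideal (AdjoinRoot h₂)) [Q.IsPrime] (hQ : Q = RingHom.ker κ) : ringKrullDim (Localization.AtPrime Q) = (1 : ℕ) := by
  rw [IsLocalization.AtPrime.ringKrullDim_eq_height Q (Localization.AtPrime Q)]
  subst hQ
  rw [height_kerKillMap k h₁ hh₁ h₂ hh₂ κ hκ]
  rfl

/-- `w̄ ∉ 𝔮` (`κ(w̄) = w ≠ 0`). [plumbing] -/
theorem algebraMap_X1_not_mem (h₁ : Polynomial (MvPolynomial (Fin 5) k)) (h₂ : Polynomial (AdjoinRoot h₁))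
    (κ : AdjoinRoot h₂ →+* MvPolynomial (Fin 5) k)
    (hκ : κ.comp (algebraMap (MvPolynomial (Fin 5) k) (AdjoinRoot h₂)) = (aeval (fun i : Fin 5 => if i = 0 then (0 : MvPolynomial (Fin 5) k) else X i)).toRingHom ∧
      κ (AdjoinRoot.of h₂ (AdjoinRoot.root h₁)) = 0 ∧ κ (AdjoinRoot.root h₂) = 0)
    (Q : Ideal (AdjoinRoot h₂)) (hQ : Q = RingHom.ker κ) : algebraMap (MvPolynomial (Fin 5) k) (AdjoinRoot h₂) (X 1) ∉ Q := by
  rw [hQ, RingHom.mem_ker, killMap_algebraMap k h₁ h₂ κ hκ, killY_X, if_neg (show (1 : Fin 5) ≠ 0 by decide)]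
  exact X_ne_zero 1

/-! ## §2 ★★ The local ring `(T₂)_𝔮` is NOT FULL -/

set_option maxHeartbeats 800000 in
-- one two-level tower lift + one localization lift into `F[ε]` and several ideal-membership computations (budget of p634876's two-ε witness)
/-- ★★ **`¬ FullCl 2 ((T₂)_𝔮)` AT `𝔮 = ker κ = (ȳ, x̄, z̄′)`**: `dim (T₂)_𝔮 = 1`, `s = (x̄)` is a system of parameters (`√(s) ∋ ȳ, z̄′` since `w̄` is a unit),
`z̄′² ∈ (x̄²)`, but `z̄′ ∉ (x̄)(T₂)_𝔮` — witnessed by `(T₂)_𝔮 → F[ε]` for ANY field `F` receiving `B₀ = k[y, w, u′, t′, s′]` injectively (`y ↦ 0`, `x̄ ↦ 0`, `z̄′ ↦ ε`;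
`z̄′ ↦ ε ≠ 0`). Over ANY field `k`. [OURS · certificate; cite: Fedder1983, Prop. 1.7 (context)] -/
theorem not_fullCl_localization_kerKillMap_of_injective {F : Type} [Field F] (ι : MvPolynomial (Fin 5) k →+* F) (hι : Function.Injective ι)
    (h₁ : Polynomial (MvPolynomial (Fin 5) k)) (hh₁ : h₁ = Polynomial.X ^ 2 - Polynomial.C (X 0 * X 1))
    (h₂ : Polynomial (AdjoinRoot h₁))
    (hh₂ : h₂ = Polynomial.X ^ 2 + (Polynomial.C (algebraMap (MvPolynomial (Fin 5) k) (AdjoinRoot h₁) (X 0 * X 1 ^ 2)) * Polynomial.X +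
      Polynomial.C (algebraMap (MvPolynomial (Fin 5) k) (AdjoinRoot h₁) (X 0 * (1 + X 2 ^ 3 + X 3 ^ 3 + X 4 ^ 3)))))
    (κ : AdjoinRoot h₂ →+* MvPolynomial (Fin 5) k)
    (hκ : κ.comp (algebraMap (MvPolynomial (Fin 5) k) (AdjoinRoot h₂)) = (aeval (fun i : Fin 5 => if i = 0 then (0 : MvPolynomial (Fin 5) k) else X i)).toRingHom ∧
      κ (AdjoinRoot.of h₂ (AdjoinRoot.root h₁)) = 0 ∧ κ (AdjoinRoot.root h₂) = 0)
    (Q : Ideal (AdjoinRoot h₂)) [Q.IsPrime] (hQ : Q = RingHom.ker κ) : ¬ FullCl 2 (Localization.AtPrime Q) := by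
  classical
  intro hfull
  set L := Localization.AtPrime Q with hL
  set alg : AdjoinRoot h₂ →+* L := algebraMap (AdjoinRoot h₂) L with halg
  have hQeq : Q = Ideal.span {algebraMap (MvPolynomial (Fin 5) k) (AdjoinRoot h₂) (X 0), AdjoinRoot.of h₂ (AdjoinRoot.root h₁), AdjoinRoot.root h₂} := by
    rw [hQ, ker_killMap_eq k h₁ hh₁ h₂ hh₂ κ hκ]
  have hxQ : AdjoinRoot.of h₂ (AdjoinRoot.root h₁) ∈ Q := hQeq ▸ Ideal.subset_span (Set.mem_insert_of_mem _ (Set.mem_insert _ _))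
  have hwQ : algebraMap (MvPolynomial (Fin 5) k) (AdjoinRoot h₂) (X 1) ∉ Q := algebraMap_X1_not_mem k h₁ h₂ κ hκ Q hQ
  -- (1) the dimension
  have hdim : ringKrullDim L = (1 : ℕ) := ringKrullDim_localization_kerKillMap k h₁ hh₁ h₂ hh₂ κ hκ Q hQ
  -- (2) the system of parameters `s = (x̄)` and the relations in `L`; `w̄` is a unit of `L`
  have hwu : IsUnit (alg (algebraMap (MvPolynomial (Fin 5) k) (AdjoinRoot h₂) (X 1))) :=
    IsLocalization.map_units L (⟨algebraMap (MvPolynomial (Fin 5) k) (AdjoinRoot h₂) (X 1), hwQ⟩ : Q.primeCompl)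
  let s : Fin 1 → L := ![alg (AdjoinRoot.of h₂ (AdjoinRoot.root h₁))]
  have hxs : alg (AdjoinRoot.of h₂ (AdjoinRoot.root h₁)) ∈ Ideal.span (Set.range s) := Ideal.subset_span ⟨0, rfl⟩
  have hx2 : alg (AdjoinRoot.of h₂ (AdjoinRoot.root h₁)) ^ 2 = alg (algebraMap (MvPolynomial (Fin 5) k) (AdjoinRoot h₂) (X 0)) * alg (algebraMap (MvPolynomial (Fin 5) k) (AdjoinRoot h₂) (X 1)) := by
    rw [← map_pow, x_sq_eq k h₁ hh₁ h₂, map_mul]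
  have hy_eq : alg (algebraMap (MvPolynomial (Fin 5) k) (AdjoinRoot h₂) (X 0)) = alg (AdjoinRoot.of h₂ (AdjoinRoot.root h₁)) ^ 2 * ↑(hwu.unit⁻¹) := by
    rw [hx2, mul_assoc, IsUnit.mul_val_inv, mul_one]
  have hz2 : alg (AdjoinRoot.root h₂) ^ 2 = -(alg (algebraMap (MvPolynomial (Fin 5) k) (AdjoinRoot h₂) (X 0)) * alg (algebraMap (MvPolynomial (Fin 5) k) (AdjoinRoot h₂) (X 1)) ^ 2 * alg (AdjoinRoot.root h₂) +
      alg (algebraMap (MvPolynomial (Fin 5) k) (AdjoinRoot h₂) (X 0)) * (1 + alg (algebraMap (MvPolynomial (Fin 5) k) (AdjoinRoot h₂) (X 2)) ^ 3 +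
        alg (algebraMap (MvPolynomial (Fin 5) k) (AdjoinRoot h₂) (X 3)) ^ 3 + alg (algebraMap (MvPolynomial (Fin 5) k) (AdjoinRoot h₂) (X 4)) ^ 3)) := by
    rw [← map_pow, z_sq_eq k h₁ h₂ hh₂]
    simp only [map_neg, map_add, map_mul, map_pow, map_one]
  have hy_mem : alg (algebraMap (MvPolynomial (Fin 5) k) (AdjoinRoot h₂) (X 0)) ∈ Ideal.span (Set.range s) := by
    rw [hy_eq]; exact Ideal.mul_mem_right _ _ (Ideal.pow_mem_of_mem _ hxs 2 two_pos)
  have hz2mem : alg (AdjoinRoot.root h₂) ^ 2 ∈ Ideal.span (Set.range s) := by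
    rw [hz2]
    exact (Ideal.span (Set.range s)).neg_mem (Ideal.add_mem _ (Ideal.mul_mem_right _ _ (Ideal.mul_mem_right _ _ hy_mem)) (Ideal.mul_mem_right _ _ hy_mem))
  have hmaxL : IsLocalRing.maximalIdeal L = Q.map alg := (Localization.AtPrime.map_eq_maximalIdeal (I := Q)).symm
  have hgen : ∀ r ∈ ({algebraMap (MvPolynomial (Fin 5) k) (AdjoinRoot h₂) (X 0), AdjoinRoot.of h₂ (AdjoinRoot.root h₁), AdjoinRoot.root h₂} : Set (AdjoinRoot h₂)),
      alg r ∈ (Ideal.span (Set.range s)).radical := by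
    intro r hr
    rcases hr with rfl | rfl | rfl
    · exact Ideal.le_radical hy_mem
    · exact Ideal.le_radical hxs
    · exact ⟨2, hz2mem⟩
  have hle : Ideal.span (Set.range s) ≤ IsLocalRing.maximalIdeal L := by
    rw [Ideal.span_le, hmaxL]
    rintro _ ⟨j, rfl⟩
    fin_cases j
    exact Ideal.mem_map_of_mem alg hxQ
  have hrad_eq : (Ideal.span (Set.range s)).radical = IsLocalRing.maximalIdeal L := by
    apply le_antisymm
    · exact (Ideal.radical_mono hle).trans_eq (IsLocalRing.maximalIdeal.isMaximal L).isPrime.radical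
    · rw [hmaxL]
      refine Ideal.map_le_iff_le_comap.mpr fun q hq => ?_
      rw [hQeq] at hq
      refine (Ideal.span_le.mpr ?_) hq
      rintro r hr
      exact hgen r hr
  have hrad : (Ideal.span (Set.range s)).radical.IsMaximal := by
    rw [hrad_eq]; exact IsLocalRing.maximalIdeal.isMaximal L
  -- (3) clause 3 of `FullCl 2` at `y = z̄′`, `e = 1`: `z̄′² = x̄²·(−w̄⁻¹(w̄²z̄′ + 1 + Σ′))`
  obtain ⟨-, hclause⟩ := hfull
  have hsq : alg (AdjoinRoot.root h₂) ^ 2 ∈ Ideal.span ((fun q : L => q ^ 2) '' (Ideal.span (Set.range s) : Set L)) := by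
    have e : alg (AdjoinRoot.root h₂) ^ 2 = alg (AdjoinRoot.of h₂ (AdjoinRoot.root h₁)) ^ 2 *
        (↑(hwu.unit⁻¹) * -(alg (algebraMap (MvPolynomial (Fin 5) k) (AdjoinRoot h₂) (X 1)) ^ 2 * alg (AdjoinRoot.root h₂) +
          (1 + alg (algebraMap (MvPolynomial (Fin 5) k) (AdjoinRoot h₂) (X 2)) ^ 3 + alg (algebraMap (MvPolynomial (Fin 5) k) (AdjoinRoot h₂) (X 3)) ^ 3 +
            alg (algebraMap (MvPolynomial (Fin 5) k) (AdjoinRoot h₂) (X 4)) ^ 3))) := by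
      rw [hz2, hy_eq]; ring
    rw [e]
    exact Ideal.mul_mem_right _ _ (Ideal.subset_span (Set.mem_image_of_mem _ hxs))
  have hF3 : alg (AdjoinRoot.root h₂) ∈ Ideal.span (Set.range s) :=
    (hclause 1 hdim s hrad).2 _ ⟨1, by simpa only [pow_one] using hsq⟩
  -- (4) `z̄′ ∉ (x̄)(T₂)_𝔮`: the one-ε target `F[ε]` (`F ⊇ B₀` any field, e.g. `Frac B₀`; `y ↦ 0`)
  let g : MvPolynomial (Fin 5) k →+* DualNumber F :=
    (TrivSqZeroExt.inlHom F F).comp (ι.comp (aeval (fun i : Fin 5 => if i = 0 then (0 : MvPolynomial (Fin 5) k) else X i)).toRingHom)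
  have hgapply : ∀ b, g b = TrivSqZeroExt.inl (ι (aeval (fun i : Fin 5 => if i = 0 then (0 : MvPolynomial (Fin 5) k) else X i) b)) := fun b => rfl
  have hgy : g (X 0) = 0 := by rw [hgapply, killY_X]; simp
  obtain ⟨φ₁, hφB, hφx, hφz⟩ : ∃ φ₁ : AdjoinRoot h₂ →+* DualNumber F,
      φ₁.comp (algebraMap (MvPolynomial (Fin 5) k) (AdjoinRoot h₂)) = g ∧
        φ₁ (AdjoinRoot.of h₂ (AdjoinRoot.root h₁)) = 0 ∧ φ₁ (AdjoinRoot.root h₂) = DualNumber.eps := by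
    refine exists_towerLift (S := DualNumber F) k h₁ hh₁ h₂ hh₂ g 0 DualNumber.eps ?_ ?_
    · rw [hgy, zero_mul]; exact zero_pow two_ne_zero
    · rw [hgy, DualNumber.eps_pow_two]; ring
  have hφalg : ∀ b, φ₁ (algebraMap (MvPolynomial (Fin 5) k) (AdjoinRoot h₂) b) = g b := fun b => RingHom.congr_fun hφB b
  -- `fst ∘ φ₁ = Frac ∘ κ`
  let π₁ : DualNumber F →+* F := (TrivSqZeroExt.fstHom F F F).toRingHom
  have hπ : ∀ q : DualNumber F, π₁ q = TrivSqZeroExt.fst q := fun q => rfl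
  have hfst : π₁.comp φ₁ = ι.comp κ := by
    refine tower₂_ringHom_ext k h₁ h₂ (RingHom.ext fun b => ?_) ?_ ?_
    · change π₁ (φ₁ (algebraMap (MvPolynomial (Fin 5) k) (AdjoinRoot h₂) b)) = ι (κ (algebraMap (MvPolynomial (Fin 5) k) (AdjoinRoot h₂) b))
      rw [hφalg, killMap_algebraMap k h₁ h₂ κ hκ, hgapply, hπ, TrivSqZeroExt.fst_inl]
    · change π₁ (φ₁ (AdjoinRoot.of h₂ (AdjoinRoot.root h₁))) = ι (κ (AdjoinRoot.of h₂ (AdjoinRoot.root h₁)))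
      rw [hφx, hκ.2.1, map_zero, map_zero]
    · change π₁ (φ₁ (AdjoinRoot.root h₂)) = ι (κ (AdjoinRoot.root h₂))
      rw [hφz, hκ.2.2, map_zero, hπ, DualNumber.fst_eps]
  have hfst' : ∀ e : AdjoinRoot h₂, TrivSqZeroExt.fst (φ₁ e) = ι (κ e) := fun e => by
    rw [← hπ]; exact RingHom.congr_fun hfst e
  have hunit : ∀ y : Q.primeCompl, IsUnit (φ₁ y) := by
    rintro ⟨y, hy⟩
    change IsUnit (φ₁ y)
    rw [TrivSqZeroExt.isUnit_iff_isUnit_fst, hfst', isUnit_iff_ne_zero]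
    intro hc
    apply hy
    have hc' : κ y = 0 := hι (by rw [map_zero]; exact hc)
    change y ∈ Q
    rw [hQ, RingHom.mem_ker]; exact hc'
  let ψ : L →+* DualNumber F := IsLocalization.lift (M := Q.primeCompl) (S := L) (P := DualNumber F) (g := φ₁) hunit
  have hψ : ∀ r : AdjoinRoot h₂, ψ (alg r) = φ₁ r := fun r => IsLocalization.lift_eq (M := Q.primeCompl) (S := L) (P := DualNumber F) hunit r
  -- `ψ` kills `(s) = (x̄)` …
  have hψs : ∀ q ∈ Ideal.span (Set.range s), ψ q = 0 := by
    intro q hq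
    have hmap : Ideal.span (Set.range s) ≤ RingHom.ker ψ := by
      rw [Ideal.span_le]
      rintro _ ⟨j, rfl⟩
      rw [SetLike.mem_coe, RingHom.mem_ker]
      fin_cases j
      change ψ (alg (AdjoinRoot.of h₂ (AdjoinRoot.root h₁))) = 0
      rw [hψ, hφx]
    exact hmap hq
  -- … but `z̄′ ↦ ε ≠ 0`
  have h0 := hψs _ hF3
  rw [hψ, hφz] at h0
  have h1 := congrArg (fun q : DualNumber F => TrivSqZeroExt.snd q) h0
  simp at h1

/-- ★★ **`¬ FullCl 2 ((T₂)_𝔮)` AT `𝔮 = ker κ = (ȳ, x̄, z̄′)`** (the F-clause fails for the parameter `x̄`; target field `F = Frac B₀`). Over ANY field `k`.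
[OURS · certificate; cite: Fedder1983, Prop. 1.7 (context)] -/
theorem not_fullCl_localization_kerKillMap (h₁ : Polynomial (MvPolynomial (Fin 5) k)) (hh₁ : h₁ = Polynomial.X ^ 2 - Polynomial.C (X 0 * X 1))
    (h₂ : Polynomial (AdjoinRoot h₁))
    (hh₂ : h₂ = Polynomial.X ^ 2 + (Polynomial.C (algebraMap (MvPolynomial (Fin 5) k) (AdjoinRoot h₁) (X 0 * X 1 ^ 2)) * Polynomial.X +
      Polynomial.C (algebraMap (MvPolynomial (Fin 5) k) (AdjoinRoot h₁) (X 0 * (1 + X 2 ^ 3 + X 3 ^ 3 + X 4 ^ 3)))))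
    (κ : AdjoinRoot h₂ →+* MvPolynomial (Fin 5) k)
    (hκ : κ.comp (algebraMap (MvPolynomial (Fin 5) k) (AdjoinRoot h₂)) = (aeval (fun i : Fin 5 => if i = 0 then (0 : MvPolynomial (Fin 5) k) else X i)).toRingHom ∧
      κ (AdjoinRoot.of h₂ (AdjoinRoot.root h₁)) = 0 ∧ κ (AdjoinRoot.root h₂) = 0)
    (Q : Ideal (AdjoinRoot h₂)) [Q.IsPrime] (hQ : Q = RingHom.ker κ) : ¬ FullCl 2 (Localization.AtPrime Q) :=
  not_fullCl_localization_kerKillMap_of_injective k (algebraMap (MvPolynomial (Fin 5) k) (FractionRing (MvPolynomial (Fin 5) k)))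
    (IsFractionRing.injective (MvPolynomial (Fin 5) k) (FractionRing (MvPolynomial (Fin 5) k))) h₁ hh₁ h₂ hh₂ κ hκ Q hQ

/-! ## §3 ★★ Every point of `V(ȳ, x̄, z̄′) ⊂ Spec T₂` is a NON-FULL point -/

/-- ★★ **FLOOR 1 OF THE FIRST d = 5 ROW (P2d5C, `τ = (x̄², ȳ, ū, t̄, s̄, z̄)`) IS NON-FULL AT EVERY POINT OF THE 4-DIMENSIONAL LOCUS `V(ȳ, x̄, z̄′)` of the `D(ȳ)` chart
`Spec T₂`** (= the exceptional divisor of the chart; closed or not, rational or not): FULL descends to generizations (`ClauseLocalizes.fiClause_of_specializes`) and the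
generic point `𝔮` of the locus is not FULL (§2). [OURS · certificate; cite: Fedder1983, Prop. 1.7 (context)] -/
theorem not_fullCl_stalk_of_mem [CharP k 2] (h₁ : Polynomial (MvPolynomial (Fin 5) k)) (hh₁ : h₁ = Polynomial.X ^ 2 - Polynomial.C (X 0 * X 1))
    (h₂ : Polynomial (AdjoinRoot h₁))
    (hh₂ : h₂ = Polynomial.X ^ 2 + (Polynomial.C (algebraMap (MvPolynomial (Fin 5) k) (AdjoinRoot h₁) (X 0 * X 1 ^ 2)) * Polynomial.X +
      Polynomial.C (algebraMap (MvPolynomial (Fin 5) k) (AdjoinRoot h₁) (X 0 * (1 + X 2 ^ 3 + X 3 ^ 3 + X 4 ^ 3)))))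
    (κ : AdjoinRoot h₂ →+* MvPolynomial (Fin 5) k)
    (hκ : κ.comp (algebraMap (MvPolynomial (Fin 5) k) (AdjoinRoot h₂)) = (aeval (fun i : Fin 5 => if i = 0 then (0 : MvPolynomial (Fin 5) k) else X i)).toRingHom ∧
      κ (AdjoinRoot.of h₂ (AdjoinRoot.root h₁)) = 0 ∧ κ (AdjoinRoot.root h₂) = 0)
    (w : Spec (.of (AdjoinRoot h₂))) (hyw : algebraMap (MvPolynomial (Fin 5) k) (AdjoinRoot h₂) (X 0) ∈ w.asIdeal) (hxw : AdjoinRoot.of h₂ (AdjoinRoot.root h₁) ∈ w.asIdeal)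
    (hzw : AdjoinRoot.root h₂ ∈ w.asIdeal) :
    ¬ FullCl 2 ((Spec (.of (AdjoinRoot h₂))).presheaf.stalk w) := by
  haveI : Fact (Nat.Prime 2) := ⟨Nat.prime_two⟩
  haveI h𝔮 : (RingHom.ker κ).IsPrime := RingHom.ker_isPrime κ
  intro hfw
  -- the generic point `η = 𝔮` of `V(ȳ, x̄, z̄′)` specialises to `w`
  let η : Spec (.of (AdjoinRoot h₂)) := ⟨RingHom.ker κ, h𝔮⟩
  have hle : η.asIdeal ≤ w.asIdeal := by
    change RingHom.ker κ ≤ w.asIdeal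
    rw [ker_killMap_eq k h₁ hh₁ h₂ hh₂ κ hκ, Ideal.span_le]
    rintro r hr
    rcases hr with rfl | rfl | rfl
    · exact hyw
    · exact hxw
    · exact hzw
  have hηw : η ⤳ w := (PrimeSpectrum.le_iff_specializes _ _).mp ((PrimeSpectrum.asIdeal_le_asIdeal _ _).mp hle)
  haveI : CharP ((Spec (.of (AdjoinRoot h₂))).presheaf.stalk w) 2 :=
    FTemkinClosedPoints.charP_stalk_of_over 2 (Spec.map (CommRingCat.ofHom (algebraMap k (AdjoinRoot h₂)))) (𝟙 _) w
  have hη := ClauseLocalizes.fiClause_of_specializes 2 hηw hfw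
  -- the stalk at `η` is `(T₂)_𝔮`
  have hLη : FullCl 2 (Localization.AtPrime η.asIdeal) :=
    WFixAtNonClosedDimTwo.fullCl_of_ringEquiv 2 (Spec.stalkIso (.of _) η).commRingCatIsoToRingEquiv hη
  exact not_fullCl_localization_kerKillMap k h₁ hh₁ h₂ hh₂ κ hκ η.asIdeal rfl hLη

/-! ## §4 ★★ A NON-FULL prime of `A₀[τ/ȳ]` containing `ȳ/1` -/

set_option maxHeartbeats 800000 in
-- transport along the chart equivalence
/-- ★★ **A prime `Q ∋ ȳ/1` of `A₀[τ/ȳ] = blowupAlgebra τ ȳ` at which the chart ring of `Bl_τ(P2d5C)` is NOT FULL** (the image of `ker κ` under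
`T₂ ≃+* blowupAlgebra τ ȳ`): the input of `TauFloorInputNotFull.exists_point_over_centre_not_fullCl` for the row's «NOT F(5)-iso». Any field `k`.
[OURS · certificate; cite: Fedder1983, Prop. 1.7 (context)] -/
theorem exists_prime_not_fullCl_blowupAlgebra (f : MvPolynomial (Fin 6) k) (hf : f = X 5 ^ 2 + X 0 ^ 4 * X 5 + X 1 ^ 3 + X 2 ^ 3 + X 3 ^ 3 + X 4 ^ 3) :
    ∃ (Q : Ideal (blowupAlgebra (Ideal.span {Ideal.Quotient.mk (Ideal.span {f}) (X 0) ^ 2, Ideal.Quotient.mk (Ideal.span {f}) (X 1), Ideal.Quotient.mk (Ideal.span {f}) (X 2), Ideal.Quotient.mk (Ideal.span {f}) (X 3), Ideal.Quotient.mk (Ideal.span {f}) (X 4), Ideal.Quotient.mk (Ideal.span {f}) (X 5)} :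
        Ideal (MvPolynomial (Fin 6) k ⧸ Ideal.span {f})) (Ideal.Quotient.mk (Ideal.span {f}) (X 1)))) (_ : Q.IsPrime),
      algebraMap (MvPolynomial (Fin 6) k ⧸ Ideal.span {f}) _ (Ideal.Quotient.mk (Ideal.span {f}) (X 1)) ∈ Q ∧
      ¬ FullCl 2 (Localization.AtPrime Q) := by
  classical
  let h₁ : Polynomial (MvPolynomial (Fin 5) k) := Polynomial.X ^ 2 - Polynomial.C (X 0 * X 1)
  let h₂ : Polynomial (AdjoinRoot h₁) := Polynomial.X ^ 2 + (Polynomial.C (algebraMap (MvPolynomial (Fin 5) k) (AdjoinRoot h₁) (X 0 * X 1 ^ 2)) * Polynomial.X +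
      Polynomial.C (algebraMap (MvPolynomial (Fin 5) k) (AdjoinRoot h₁) (X 0 * (1 + X 2 ^ 3 + X 3 ^ 3 + X 4 ^ 3))))
  obtain ⟨κ, hκ⟩ := exists_killMap k h₁ rfl h₂ rfl
  obtain ⟨e, -, heX, -, -⟩ := TauFloorP2d5CYChartIdent.exists_chartEquiv k f hf h₁ rfl h₂ rfl
  haveI : (RingHom.ker κ).IsPrime := RingHom.ker_isPrime κ
  let Q := (RingHom.ker κ).map e.toRingHom
  haveI hQ : Q.IsPrime := Ideal.map_isPrime_of_equiv e
  have hcomap : Q.comap e.toRingHom = RingHom.ker κ := Ideal.comap_map_of_bijective e.toRingHom e.bijective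
  haveI : (Q.comap e.toRingHom).IsPrime := Ideal.IsPrime.comap _
  refine ⟨Q, hQ, ?_, fun hfull => ?_⟩
  · -- `ȳ/1 = e (y)`, and `y ∈ ker κ`
    have hy : algebraMap (MvPolynomial (Fin 5) k) (AdjoinRoot h₂) (X 0) ∈ RingHom.ker κ := by
      rw [RingHom.mem_ker, killMap_algebraMap k h₁ h₂ κ hκ, killY_X]; simp
    have hval : e (algebraMap (MvPolynomial (Fin 5) k) (AdjoinRoot h₂) (X 0)) =
        algebraMap (MvPolynomial (Fin 6) k ⧸ Ideal.span {f}) _ (Ideal.Quotient.mk (Ideal.span {f}) (X 1)) := by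
      apply Subtype.ext
      rw [heX 0, Subalgebra.coe_algebraMap]
      rfl
    rw [← hval]
    exact Ideal.mem_map_of_mem _ hy
  · obtain ⟨eQ⟩ := E8Char5FiModel.nonempty_ringEquiv_localization_comap e Q
    exact not_fullCl_localization_kerKillMap k h₁ rfl h₂ rfl κ hκ (Q.comap e.toRingHom) hcomap
      (WFixAtNonClosedDimTwo.fullCl_of_ringEquiv 2 eQ.symm hfull)

end Summit.ResolutionOfSingularities.ResolutionOfSingularities.Theorems.FInjectiveMacaulayfication.TauFloorP2d5CYChartNotFull

end
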